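import Literature.Analysis.FluidPDE.SteadyNSLatticePersistence
import HarnessLib

/-!
# Time-periodic Navier–Stokes on `T³` in space–time Fourier coefficients, I: the parabolic
# lattice `ℤ × ℤ³`, its weight `Λ(n,k) = |n| + |k|²`, and the `L²` bound of the convective symbol
# in the maximal-regularity class (Iooss 1972; Henry 1981, Ch. 8; Kielhöfer 2012, §I.8–I.12)

Analysis/FluidPDE proof file (theorems only; no definitions, no named facts). First file of the
space–time Fourier ("Lyapunov–Schmidt in spaces of time-periodic functions") treatment of
time-periodic solutions of the incompressible Navier–Stokes system on the flat torus `T³`, written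
for the discharge of `Literature.Analysis.FluidPDE.PeriodicNSOrbitPersists` (D. Henry, LNM 840,
Ch. 8: persistence of a periodic orbit whose Floquet multiplier `1` is simple). A `τ`-periodic
velocity `u(t, x)` with conserved mean is encoded, after the time rescaling `s = t/τ ∈ ℝ/ℤ`, by its
space–time Fourier coefficients `û(n, k)`, `(n, k) ∈ 𝕃 := ℤ × ℤ³`, `k ≠ 0`; the operator
`ω∂ₛ − νΔ` has the symbol `2πiωn + 4π²ν|k|²`, comparable to the **parabolic weight**
`Λ(n, k) = |n| + |k|²`, and the maximal-regularity class `∂ₛu, Δu ∈ L²(S¹ × T³)` is the weighted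
space `Λ û ∈ ℓ²(𝕃)`. The force enters through `L²` (the persistence theorem perturbs the force in
sup norm only), which forces this choice of spaces; the price is that `Λû ∈ ℓ²` does NOT make `û`
summable (`∑ Λ⁻² = ∞`), so the convective term cannot be bounded by Young's inequality as in the
steady file `SteadyNSLatticePersistence` (`H² ⊂ A(T³)`). This file proves the replacement:

* §A the weight: `Λ ≥ |k|² ≥ 1` off the zero modes, `|n| ≤ Λ`, the parabolic triangle inequality
  `Λ(m) ≤ 2Λ(m') + 2Λ(m − m')`;
* §B lattice sums: `∑_{n ∈ ℤ} (|n| + a)⁻² ≤ 3/a` (`a ≥ 1`), and the **kernel bound**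
  `sup_{(n,k)} ∑_{(n',k')} ⟨k − k'⟩² / (Λ(n',k')² Λ(n−n',k−k')²) ≤ 12 Z`, `Z = ∑_{k≠0} |k|⁻⁴`
  (sum in `n'` first: `3/|k'|²`, the other factor at most `|k−k'|⁻⁴·2|k−k'|²`; then
  `6/(|k'|²|k−k'|²) ≤ 3|k'|⁻⁴ + 3|k−k'|⁻⁴`);
* §C the convective symbol `N(a,b)(n,k) = ∑_{(n',k')} (a(n',k')·2πi(k−k')) b(n−n',k−k')` on `𝕃`
  (componentwise the tree's lattice convolution pattern of `ScalarFourier.transportSym`, one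
  dimension up): pointwise bound, transversal form (`k'·a(n',k') = 0 ⇒` the derivative moves to
  `k`), vanishing at `k = 0`, conjugate symmetry;
* §D **the bilinear `L²` estimate** `∑_m ‖N(x/Λ, y/Λ)(m)‖² ≤ (18π)² · 12Z · ‖x‖²_{ℓ²} ‖y‖²_{ℓ²}`
  for families vanishing on the zero spatial modes (Cauchy–Schwarz against the kernel of §B, then
  Fubini and translation invariance), i.e. `(v·∇)w ∈ L²(S¹×T³)` with
  `‖(v·∇)w‖_{L²} ≲ (‖∂ₛv‖_{L²} + ‖Δv‖_{L²})(‖∂ₛw‖_{L²} + ‖Δw‖_{L²})` for mean-zero fields on `T³`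
  — the `3`-dimensional maximal-regularity product estimate behind the implicit-function treatment
  of time-periodic Navier–Stokes flows (Iooss 1972; Kielhöfer 2012, §I.8 (I.8.9)–(I.8.15) with
  Prop. I.8.1, PDF pp. 59–60, for the abstract frame `G(x, κ, λ) = κ dx/dt − F(x, λ)` on
  `2π`-periodic functions, `J₀ = κ₀ d/dt − A₀` Fredholm of index zero; §I.12, PDF pp. 104–105:
  Floquet exponents = eigenvalues of `d/dt − D_xF(x(t), λ)` on `p`-periodic functions, the
  exponent `0` with eigenfunction `dx/dt` giving the multiplier `1`).

Design: as in `SteadyNSLatticePersistence`, no definitions — the weight, the inverse weight and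
the symbol are local notations over existing vocabulary (`Torus.freqNormSq`, `Torus.sobolevWeight`,
`ScalarFourier.dsym`), all estimates are in `ℝ≥0∞` (unconditional sums). Not here: the Hilbert
spaces, the linear isomorphism `ω∂ₛ − νΔ`, compactness of the linearised convective operator,
the Fredholm/bordered implicit-function step, regularity, and the dictionary with classical
solutions (sequel files).

## References

* G. Iooss, *Existence et stabilité de la solution périodique secondaire intervenant dans les
  problèmes d'évolution du type Navier–Stokes*, Arch. Rational Mech. Anal. 47 (1972) 301–329
  (time-periodic Navier–Stokes flows by implicit-function arguments in spaces of periodic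
  functions). [Iooss1972]
* D. Henry, *Geometric Theory of Semilinear Parabolic Equations*, LNM 840, Springer (1981), Ch. 8
  §8.2–8.3 (nondegenerate periodic orbits persist). [Henry1981]
* H. Kielhöfer, *Bifurcation Theory*, 2nd ed., Springer (2012), §I.8 (I.8.9)–(I.8.15), Prop. I.8.1
  (PDF pp. 59–60: the operator `κ d/dt − A₀` on `2π`-periodic functions is Fredholm of index
  zero); §I.12 (PDF pp. 104–105: period map, Floquet multipliers versus Floquet exponents).
  [Kielhofer2012]
* R. Temam, *Navier–Stokes Equations*, North-Holland (1979), Ch. III §3 (function spaces for the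
  evolution problem on the torus). [Temam1979]
-/

noncomputable section

open scoped BigOperators Topology ENNReal NNReal ComplexConjugate
open Filter Set Function

namespace Literature.Analysis.FluidPDE

namespace TimePeriodicLattice

open Literature.Analysis.FunctionSpaces Literature.Analysis.FunctionSpaces.Torus
open Literature.Analysis.FluidPDE.ScalarFourier

/-- Local notation: the parabolic weight `Λ(n, k) = |n| + |k|²` of a space–time frequency
`m = (n, k) ∈ ℤ × ℤ³`. -/
local notation:max "Λ" m:max => (|((Prod.fst m : ℤ) : ℝ)| + freqNormSq (Prod.snd m))

/-! ## §A The parabolic weight -/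

section Weight

/-- Unfolding the weight. [folklore] -/
theorem wt_apply (m : ℤ × (Fin 3 → ℤ)) : Λ m = |((m.1 : ℤ) : ℝ)| + freqNormSq m.2 := rfl

/-- `Λ ≥ 0`. [folklore] -/
theorem wt_nonneg (m : ℤ × (Fin 3 → ℤ)) : 0 ≤ Λ m :=
  add_nonneg (abs_nonneg _) (freqNormSq_nonneg _)

/-- `|k|² ≤ Λ(n, k)`. [folklore] -/
theorem freqNormSq_le_wt (m : ℤ × (Fin 3 → ℤ)) : freqNormSq m.2 ≤ Λ m :=
  le_add_of_nonneg_left (abs_nonneg _)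

/-- `|n| ≤ Λ(n, k)`. [folklore] -/
theorem abs_le_wt (m : ℤ × (Fin 3 → ℤ)) : |((m.1 : ℤ) : ℝ)| ≤ Λ m :=
  le_add_of_nonneg_right (freqNormSq_nonneg _)

/-- Off the zero spatial modes the weight is at least one: `k ≠ 0 ⇒ 1 ≤ Λ(n, k)`. [folklore] -/
theorem one_le_wt {m : ℤ × (Fin 3 → ℤ)} (hm : m.2 ≠ 0) : 1 ≤ Λ m :=
  (Torus.one_le_freqNormSq hm).trans (freqNormSq_le_wt m)

/-- Off the zero spatial modes the weight is positive. [folklore] -/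
theorem wt_pos {m : ℤ × (Fin 3 → ℤ)} (hm : m.2 ≠ 0) : 0 < Λ m :=
  zero_lt_one.trans_le (one_le_wt hm)

/-- `Λ(m) = 0` exactly at the origin `m = (0, 0)`. [folklore] -/
theorem wt_eq_zero_iff (m : ℤ × (Fin 3 → ℤ)) : Λ m = 0 ↔ m = 0 := by
  constructor
  · intro h
    have h1 : |((m.1 : ℤ) : ℝ)| = 0 := by
      linarith [abs_nonneg ((m.1 : ℤ) : ℝ), freqNormSq_nonneg m.2]
    have h2 : freqNormSq m.2 = 0 := by
      linarith [abs_nonneg ((m.1 : ℤ) : ℝ), freqNormSq_nonneg m.2]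
    have h1' : m.1 = 0 := by exact_mod_cast (abs_eq_zero.1 h1)
    have h2' : m.2 = 0 := (Torus.freqNormSq_eq_zero_iff m.2).1 h2
    exact Prod.ext h1' h2'
  · rintro rfl
    simp

/-- The weight is even: `Λ(−m) = Λ(m)`. [folklore] -/
theorem wt_neg (m : ℤ × (Fin 3 → ℤ)) : Λ (-m) = Λ m := by
  rw [Prod.fst_neg, Prod.snd_neg, Int.cast_neg, abs_neg, freqNormSq_neg]

/-- **Parabolic triangle inequality**: `Λ(m) ≤ 2Λ(m') + 2Λ(m − m')`
(`|n| ≤ |n'| + |n − n'|`, `|k|² ≤ 2|k'|² + 2|k − k'|²`). [folklore] -/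
theorem wt_le_two_mul_add (m m' : ℤ × (Fin 3 → ℤ)) : Λ m ≤ 2 * Λ m' + 2 * Λ (m - m') := by
  have h1 : |((m.1 : ℤ) : ℝ)| ≤ |((m'.1 : ℤ) : ℝ)| + |(((m - m').1 : ℤ) : ℝ)| := by
    have : ((m.1 : ℤ) : ℝ) = ((m'.1 : ℤ) : ℝ) + (((m - m').1 : ℤ) : ℝ) := by
      push_cast [Prod.fst_sub]; ring
    rw [this]
    exact abs_add_le _ _
  have h2 : freqNormSq m.2 ≤ 2 * freqNormSq (m - m').2 + 2 * freqNormSq m'.2 := by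
    have := SteadyNS.freqNormSq_le_two_mul_add m.2 m'.2
    simpa [Prod.snd_sub] using this
  linarith [abs_nonneg ((m'.1 : ℤ) : ℝ), abs_nonneg (((m - m').1 : ℤ) : ℝ), freqNormSq_nonneg m'.2,
    freqNormSq_nonneg (m - m').2]

end Weight

/-! ## §B Lattice sums: the one-dimensional sum and the kernel bound -/

section Sums

/-- Telescoping bound for the shifted `p = 2` series:
`∑_{i<N} ((i + 1 + a)²)⁻¹ ≤ a⁻¹ − (N + a)⁻¹` for `a > 0`. [folklore] -/
theorem sum_range_inv_sq_le {a : ℝ} (ha : 0 < a) (N : ℕ) :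
    ∑ i ∈ Finset.range N, (((i : ℝ) + 1 + a) ^ 2)⁻¹ ≤ a⁻¹ - ((N : ℝ) + a)⁻¹ := by
  induction N with
  | zero => simp
  | succ N ih =>
    rw [Finset.sum_range_succ]
    have hN : 0 < (N : ℝ) + a := by positivity
    have hN1 : 0 < (N : ℝ) + 1 + a := by positivity
    have hstep : (((N : ℝ) + 1 + a) ^ 2)⁻¹ ≤ ((N : ℝ) + a)⁻¹ - ((N : ℝ) + 1 + a)⁻¹ := by
      rw [inv_sub_inv hN.ne' hN1.ne', show (N : ℝ) + 1 + a - ((N : ℝ) + a) = 1 by ring, one_div]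
      exact inv_anti₀ (by positivity) (by nlinarith)
    push_cast
    linarith

/-- The shifted series in `ℝ≥0∞`: `∑_{i ∈ ℕ} ((i + 1 + a)²)⁻¹ ≤ a⁻¹` for `a > 0`. [folklore] -/
theorem tsum_inv_sq_succ_le {a : ℝ} (ha : 0 < a) :
    ∑' i : ℕ, ENNReal.ofReal ((((i : ℝ) + 1 + a) ^ 2)⁻¹) ≤ ENNReal.ofReal a⁻¹ := by
  refine ENNReal.tsum_le_of_sum_range_le fun N => ?_
  rw [← ENNReal.ofReal_sum_of_nonneg fun i _ => by positivity]
  refine ENNReal.ofReal_le_ofReal ((sum_range_inv_sq_le ha N).trans ?_)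
  have : 0 ≤ ((N : ℝ) + a)⁻¹ := by positivity
  linarith

/-- **The one-dimensional sum**: `∑_{n ∈ ℤ} ((|n| + a)²)⁻¹ ≤ 3/a` for `a ≥ 1`
(`= a⁻² + 2∑_{n ≥ 1}(n + a)⁻² ≤ a⁻² + 2a⁻¹`). [folklore] -/
theorem tsum_int_inv_sq_le {a : ℝ} (ha : 1 ≤ a) :
    ∑' n : ℤ, ENNReal.ofReal (((|((n : ℤ) : ℝ)| + a) ^ 2)⁻¹) ≤ ENNReal.ofReal (3 / a) := by
  have ha0 : 0 < a := zero_lt_one.trans_le ha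
  have hsplit := tsum_of_nat_of_neg_add_one
    (f := fun n : ℤ => ENNReal.ofReal (((|((n : ℤ) : ℝ)| + a) ^ 2)⁻¹)) ENNReal.summable ENNReal.summable
  rw [hsplit]
  have hneg : ∀ n : ℕ, ENNReal.ofReal (((|(((-(n + 1 : ℕ) : ℤ) : ℤ) : ℝ)| + a) ^ 2)⁻¹) =
      ENNReal.ofReal ((((n : ℝ) + 1 + a) ^ 2)⁻¹) := by
    intro n
    have : |(((-(n + 1 : ℕ) : ℤ) : ℤ) : ℝ)| = (n : ℝ) + 1 := by
      rw [Int.cast_neg, abs_neg, Int.cast_natCast, Nat.cast_add, Nat.cast_one]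
      exact abs_of_nonneg (by positivity)
    rw [this]
  have hpos : ∀ n : ℕ, ENNReal.ofReal (((|(((n + 1 : ℕ) : ℤ) : ℝ)| + a) ^ 2)⁻¹) =
      ENNReal.ofReal ((((n : ℝ) + 1 + a) ^ 2)⁻¹) := by
    intro n
    have : |(((n + 1 : ℕ) : ℤ) : ℝ)| = (n : ℝ) + 1 := by
      rw [Int.cast_natCast, Nat.cast_add, Nat.cast_one]
      exact abs_of_nonneg (by positivity)
    rw [this]
  have h1 : ∑' n : ℕ, ENNReal.ofReal (((|(((-(n + 1 : ℕ) : ℤ) : ℤ) : ℝ)| + a) ^ 2)⁻¹) ≤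
      ENNReal.ofReal a⁻¹ := by
    refine le_trans (le_of_eq (tsum_congr hneg)) (tsum_inv_sq_succ_le ha0)
  have h2 : ∑' n : ℕ, ENNReal.ofReal (((|(((n : ℕ) : ℤ) : ℝ)| + a) ^ 2)⁻¹) ≤
      ENNReal.ofReal a⁻¹ + ENNReal.ofReal a⁻¹ := by
    rw [tsum_eq_zero_add' (f := fun n : ℕ => ENNReal.ofReal (((|(((n : ℕ) : ℤ) : ℝ)| + a) ^ 2)⁻¹))
      ENNReal.summable]
    refine add_le_add ?_ (le_trans (le_of_eq (tsum_congr hpos)) (tsum_inv_sq_succ_le ha0))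
    simp only [Nat.cast_zero, Int.cast_zero, abs_zero, zero_add]
    refine ENNReal.ofReal_le_ofReal (inv_anti₀ ha0 ?_)
    nlinarith
  have h3 : ENNReal.ofReal (3 / a) = ENNReal.ofReal a⁻¹ + ENNReal.ofReal a⁻¹ + ENNReal.ofReal a⁻¹ := by
    rw [← ENNReal.ofReal_add (by positivity) (by positivity),
      ← ENNReal.ofReal_add (by positivity) (by positivity)]
    congr 1
    rw [div_eq_mul_inv]
    ring
  rw [h3]
  exact add_le_add h2 h1

/-- The constant `Z = ∑_{k ∈ ℤ³} (|k|²)⁻²` (junk `0` at `k = 0`) is finite. [folklore] -/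
theorem zConst_ne_top : ∑' k : (Fin 3 → ℤ), ENNReal.ofReal ((freqNormSq k)⁻¹) ^ 2 ≠ ∞ :=
  SteadyLattice.tsum_inv_freqNormSq_sq_ne_top

/-- The sum in `n'` of the kernel at fixed spatial frequencies `k' ≠ 0`, `k − k' ≠ 0`:
`∑_{n'} ⟨k−k'⟩² / (Λ(n',k')² Λ(n−n',k−k')²) ≤ 6 / (|k'|² |k−k'|²)`. [folklore] -/
theorem tsum_kernel_fst_le (n : ℤ) {k k' : Fin 3 → ℤ} (hk' : k' ≠ 0) (hkk' : k - k' ≠ 0) :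
    ∑' n' : ℤ, ENNReal.ofReal (sobolevWeight 1 (k - k') ^ 2 *
        (((Λ (n', k')) ^ 2)⁻¹ * ((Λ ((n, k) - (n', k'))) ^ 2)⁻¹)) ≤
      ENNReal.ofReal (6 * ((freqNormSq k')⁻¹ * (freqNormSq (k - k'))⁻¹)) := by
  have ha : 1 ≤ freqNormSq k' := Torus.one_le_freqNormSq hk'
  have hb : 1 ≤ freqNormSq (k - k') := Torus.one_le_freqNormSq hkk'
  have ha0 : 0 < freqNormSq k' := by linarith
  have hb0 : 0 < freqNormSq (k - k') := by linarith
  -- pointwise: `⟨k''⟩² Λ'⁻² Λ''⁻² ≤ (2/|k''|²) · (|n'| + |k'|²)⁻²`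
  have hpt : ∀ n' : ℤ, sobolevWeight 1 (k - k') ^ 2 *
      (((Λ (n', k')) ^ 2)⁻¹ * ((Λ ((n, k) - (n', k'))) ^ 2)⁻¹) ≤
      2 * (freqNormSq (k - k'))⁻¹ * (((|((n' : ℤ) : ℝ)| + freqNormSq k') ^ 2)⁻¹) := by
    intro n'
    have hw : sobolevWeight 1 (k - k') ^ 2 ≤ 2 * freqNormSq (k - k') :=
      SteadyLattice.sobolevWeight_one_sq_le hkk'
    have hL'' : freqNormSq (k - k') ≤ Λ ((n, k) - (n', k')) := freqNormSq_le_wt ((n, k) - (n', k'))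
    have hL''2 : ((Λ ((n, k) - (n', k'))) ^ 2)⁻¹ ≤ ((freqNormSq (k - k')) ^ 2)⁻¹ :=
      inv_anti₀ (by positivity) (pow_le_pow_left₀ hb0.le hL'' 2)
    have hL' : ((Λ (n', k')) ^ 2)⁻¹ = (((|((n' : ℤ) : ℝ)| + freqNormSq k') ^ 2)⁻¹) := rfl
    rw [hL']
    have hx : 0 ≤ (((|((n' : ℤ) : ℝ)| + freqNormSq k') ^ 2)⁻¹) := by positivity
    calc sobolevWeight 1 (k - k') ^ 2 *
          ((((|((n' : ℤ) : ℝ)| + freqNormSq k') ^ 2)⁻¹) * ((Λ ((n, k) - (n', k'))) ^ 2)⁻¹)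
        ≤ (2 * freqNormSq (k - k')) *
          ((((|((n' : ℤ) : ℝ)| + freqNormSq k') ^ 2)⁻¹) * ((freqNormSq (k - k')) ^ 2)⁻¹) :=
          mul_le_mul hw (mul_le_mul_of_nonneg_left hL''2 hx) (by positivity) (by positivity)
      _ = 2 * (freqNormSq (k - k'))⁻¹ * (((|((n' : ℤ) : ℝ)| + freqNormSq k') ^ 2)⁻¹) := by
          field_simp
  calc ∑' n' : ℤ, ENNReal.ofReal (sobolevWeight 1 (k - k') ^ 2 *
        (((Λ (n', k')) ^ 2)⁻¹ * ((Λ ((n, k) - (n', k'))) ^ 2)⁻¹))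
      ≤ ∑' n' : ℤ, ENNReal.ofReal (2 * (freqNormSq (k - k'))⁻¹) *
          ENNReal.ofReal (((|((n' : ℤ) : ℝ)| + freqNormSq k') ^ 2)⁻¹) := by
        refine ENNReal.tsum_le_tsum fun n' => ?_
        rw [← ENNReal.ofReal_mul (by positivity)]
        exact ENNReal.ofReal_le_ofReal (hpt n')
    _ = ENNReal.ofReal (2 * (freqNormSq (k - k'))⁻¹) *
          ∑' n' : ℤ, ENNReal.ofReal (((|((n' : ℤ) : ℝ)| + freqNormSq k') ^ 2)⁻¹) :=
        ENNReal.tsum_mul_left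
    _ ≤ ENNReal.ofReal (2 * (freqNormSq (k - k'))⁻¹) * ENNReal.ofReal (3 / freqNormSq k') :=
        by gcongr; exact tsum_int_inv_sq_le ha
    _ = ENNReal.ofReal (6 * ((freqNormSq k')⁻¹ * (freqNormSq (k - k'))⁻¹)) := by
        rw [← ENNReal.ofReal_mul (by positivity)]
        congr 1
        rw [div_eq_mul_inv]
        ring

/-- **The kernel bound**: for every space–time frequency `m = (n, k)`,
`∑_{m' = (n',k'), k' ≠ 0, k−k' ≠ 0} ⟨k−k'⟩² / (Λ(m')² Λ(m−m')²) ≤ 12 Z` with `Z = ∑_{k≠0}|k|⁻⁴`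
(sum in `n'` first; then `6/(|k'|²|k−k'|²) ≤ 3|k'|⁻⁴ + 3|k−k'|⁻⁴` and translation invariance).
This is the finiteness that makes `(v·∇)w ∈ L²` for `v, w` in the maximal-regularity class in
three space dimensions. [folklore] -/
theorem tsum_kernel_le (m : ℤ × (Fin 3 → ℤ)) :
    ∑' m' : ℤ × (Fin 3 → ℤ), (if m'.2 = 0 ∨ m.2 - m'.2 = 0 then 0 else
        ENNReal.ofReal (sobolevWeight 1 (m.2 - m'.2) ^ 2 *
          (((Λ m') ^ 2)⁻¹ * ((Λ (m - m')) ^ 2)⁻¹))) ≤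
      12 * ∑' k : (Fin 3 → ℤ), ENNReal.ofReal ((freqNormSq k)⁻¹) ^ 2 := by
  obtain ⟨n, k⟩ := m
  set Z : ℝ≥0∞ := ∑' k : (Fin 3 → ℤ), ENNReal.ofReal ((freqNormSq k)⁻¹) ^ 2 with hZ
  -- write the sum as an iterated sum, `k'` outside
  rw [ENNReal.tsum_prod', ENNReal.tsum_comm]
  -- bound the inner sum for each `k'`
  have hinner : ∀ k' : Fin 3 → ℤ, (∑' n' : ℤ, (if ((n', k') : ℤ × (Fin 3 → ℤ)).2 = 0 ∨
      ((n, k) : ℤ × (Fin 3 → ℤ)).2 - ((n', k') : ℤ × (Fin 3 → ℤ)).2 = 0 then 0 else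
        ENNReal.ofReal (sobolevWeight 1 (((n, k) : ℤ × (Fin 3 → ℤ)).2 - ((n', k') : ℤ × (Fin 3 → ℤ)).2) ^ 2 *
          (((Λ (n', k')) ^ 2)⁻¹ * ((Λ ((n, k) - (n', k'))) ^ 2)⁻¹)))) ≤
      3 * ENNReal.ofReal ((freqNormSq k')⁻¹) ^ 2 + 3 * ENNReal.ofReal ((freqNormSq (k - k'))⁻¹) ^ 2 := by
    intro k'
    by_cases h : k' = 0 ∨ k - k' = 0
    · simp only [h, if_true, tsum_zero]
      exact bot_le
    · obtain ⟨hk', hkk'⟩ := not_or.1 h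
      simp only [h, if_false]
      refine (tsum_kernel_fst_le n hk' hkk').trans ?_
      have ha0 : 0 < freqNormSq k' := by linarith [Torus.one_le_freqNormSq hk']
      have hb0 : 0 < freqNormSq (k - k') := by linarith [Torus.one_le_freqNormSq hkk']
      rw [← ENNReal.ofReal_pow (by positivity), ← ENNReal.ofReal_pow (by positivity),
        ← ENNReal.ofReal_ofNat 3, ← ENNReal.ofReal_mul (by norm_num),
        ← ENNReal.ofReal_mul (by norm_num), ← ENNReal.ofReal_add (by positivity) (by positivity)]
      refine ENNReal.ofReal_le_ofReal ?_
      -- `6ab ≤ 3a² + 3b²`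
      nlinarith [sq_nonneg ((freqNormSq k')⁻¹ - (freqNormSq (k - k'))⁻¹),
        inv_pos.2 ha0, inv_pos.2 hb0]
  calc ∑' (k' : Fin 3 → ℤ) (n' : ℤ), (if ((n', k') : ℤ × (Fin 3 → ℤ)).2 = 0 ∨
        ((n, k) : ℤ × (Fin 3 → ℤ)).2 - ((n', k') : ℤ × (Fin 3 → ℤ)).2 = 0 then 0 else
        ENNReal.ofReal (sobolevWeight 1 (((n, k) : ℤ × (Fin 3 → ℤ)).2 - ((n', k') : ℤ × (Fin 3 → ℤ)).2) ^ 2 *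
          (((Λ (n', k')) ^ 2)⁻¹ * ((Λ ((n, k) - (n', k'))) ^ 2)⁻¹)))
      ≤ ∑' k' : Fin 3 → ℤ, (3 * ENNReal.ofReal ((freqNormSq k')⁻¹) ^ 2 +
          3 * ENNReal.ofReal ((freqNormSq (k - k'))⁻¹) ^ 2) := ENNReal.tsum_le_tsum hinner
    _ = 3 * Z + 3 * Z := by
        rw [ENNReal.tsum_add, ENNReal.tsum_mul_left, ENNReal.tsum_mul_left, hZ]
        congr 2
        exact (Equiv.subLeft k).tsum_eq (fun j => ENNReal.ofReal ((freqNormSq j)⁻¹) ^ 2)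
    _ ≤ 12 * Z := by
        rw [← add_mul]
        gcongr
        norm_num

end Sums

/-! ## §C The convective symbol on the space–time lattice -/

section Symbol

/-- Local notation: the **convective symbol** on `𝕃 = ℤ × ℤ³`,
`N(a, b)(m)ₚ = ∑ⱼ ∑_{m'} a(m')ⱼ · 2πi (k − k')ⱼ · b(m − m')ₚ` (`m = (n,k)`, `m' = (n',k')`): the
space–time Fourier coefficients of `(v·∇)w` for `v̂ = a`, `ŵ = b` (a convolution in time AND
space; the spatial derivative symbol `ScalarFourier.dsym j l = 2πi lⱼ`). -/
local notation:max "𝐍[" a ", " b "]" m:max =>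
  (WithLp.toLp 2 (fun p : Fin 3 => ∑ j : Fin 3, ∑' m' : ℤ × (Fin 3 → ℤ),
    a m' j * (dsym j (Prod.snd m - Prod.snd m') * b (m - m') p)) : EuclideanSpace ℂ (Fin 3))

/-- Components of the symbol. [folklore] -/
theorem nl_apply (a b : ℤ × (Fin 3 → ℤ) → EuclideanSpace ℂ (Fin 3)) (m : ℤ × (Fin 3 → ℤ)) (p : Fin 3) :
    (𝐍[a, b] m) p = ∑ j : Fin 3, ∑' m' : ℤ × (Fin 3 → ℤ), a m' j * (dsym j (m.2 - m'.2) * b (m - m') p) := rfl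

/-- **Pointwise bound of the symbol**: `‖N(a,b)(m)‖ ≤ 18π ∑_{m'} ‖a m'‖ ⟨k−k'⟩ ‖b(m−m')‖`. [folklore] -/
theorem enorm_nl_le (a b : ℤ × (Fin 3 → ℤ) → EuclideanSpace ℂ (Fin 3)) (m : ℤ × (Fin 3 → ℤ)) :
    ‖𝐍[a, b] m‖ₑ ≤ ENNReal.ofReal (18 * Real.pi) *
      ∑' m' : ℤ × (Fin 3 → ℤ), ‖a m'‖ₑ * (ENNReal.ofReal (sobolevWeight 1 (m.2 - m'.2)) * ‖b (m - m')‖ₑ) := by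
  set S : ℝ≥0∞ := ∑' m' : ℤ × (Fin 3 → ℤ), ‖a m'‖ₑ *
    (ENNReal.ofReal (sobolevWeight 1 (m.2 - m'.2)) * ‖b (m - m')‖ₑ) with hS
  have hcomp : ∀ p, ‖(𝐍[a, b] m) p‖ₑ ≤ 3 * (ENNReal.ofReal (2 * Real.pi) * S) := by
    intro p
    rw [nl_apply]
    calc ‖∑ j : Fin 3, ∑' m' : ℤ × (Fin 3 → ℤ), a m' j * (dsym j (m.2 - m'.2) * b (m - m') p)‖ₑ
        ≤ ∑ j : Fin 3, ‖∑' m' : ℤ × (Fin 3 → ℤ), a m' j * (dsym j (m.2 - m'.2) * b (m - m') p)‖ₑ :=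
          enorm_sum_le _ _
      _ ≤ ∑ _j : Fin 3, ENNReal.ofReal (2 * Real.pi) * S := Finset.sum_le_sum fun j _ => by
          refine enorm_tsum_le_tsum_enorm.trans ?_
          rw [hS, ← ENNReal.tsum_mul_left]
          refine ENNReal.tsum_le_tsum fun m' => ?_
          rw [enorm_mul, enorm_mul]
          have h1 : ‖a m' j‖ₑ ≤ ‖a m'‖ₑ := SteadyLattice.enorm_apply_le_enorm (a m') j
          have h2 : ‖b (m - m') p‖ₑ ≤ ‖b (m - m')‖ₑ := SteadyLattice.enorm_apply_le_enorm (b (m - m')) p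
          have h3 : ‖dsym j (m.2 - m'.2)‖ₑ ≤ ENNReal.ofReal (2 * Real.pi) *
              ENNReal.ofReal (sobolevWeight 1 (m.2 - m'.2)) := by
            rw [← ofReal_norm, ← ENNReal.ofReal_mul (by positivity)]
            exact ENNReal.ofReal_le_ofReal (SteadyLattice.norm_dsym_le j (m.2 - m'.2))
          calc ‖a m' j‖ₑ * (‖dsym j (m.2 - m'.2)‖ₑ * ‖b (m - m') p‖ₑ)
              ≤ ‖a m'‖ₑ * ((ENNReal.ofReal (2 * Real.pi) * ENNReal.ofReal (sobolevWeight 1 (m.2 - m'.2))) *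
                  ‖b (m - m')‖ₑ) := mul_le_mul' h1 (mul_le_mul' h3 h2)
            _ = ENNReal.ofReal (2 * Real.pi) *
                  (‖a m'‖ₑ * (ENNReal.ofReal (sobolevWeight 1 (m.2 - m'.2)) * ‖b (m - m')‖ₑ)) := by ring
      _ = 3 * (ENNReal.ofReal (2 * Real.pi) * S) := by
          simp [Finset.sum_const, Finset.card_univ]
  calc ‖𝐍[a, b] m‖ₑ ≤ ∑ p, ‖(𝐍[a, b] m) p‖ₑ := SteadyLattice.enorm_le_sum_enorm_apply _
    _ ≤ ∑ _p : Fin 3, 3 * (ENNReal.ofReal (2 * Real.pi) * S) := Finset.sum_le_sum fun p _ => hcomp p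
    _ = ENNReal.ofReal (18 * Real.pi) * S := by
        simp only [Finset.sum_const, Finset.card_univ, Fintype.card_fin, nsmul_eq_mul, Nat.cast_ofNat]
        rw [show (18 : ℝ) * Real.pi = 9 * (2 * Real.pi) by ring,
          ENNReal.ofReal_mul (by norm_num : (0:ℝ) ≤ 9)]
        simp only [ENNReal.ofReal_ofNat]
        ring

/-- The pairing `k · v` is additive in the frequency. [folklore] -/
theorem kdot_sub (k k' : Fin 3 → ℤ) (v : EuclideanSpace ℂ (Fin 3)) :
    (∑ jj : Fin 3, (((k - k') jj : ℤ) : ℂ) * v jj) =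
      (∑ jj : Fin 3, ((k jj : ℤ) : ℂ) * v jj) - (∑ jj : Fin 3, ((k' jj : ℤ) : ℂ) * v jj) :=
  SteadyLattice.kdot_sub k k' v

/-- **Transversal form of the symbol**: if `k' · a(n',k') = 0` for all `(n',k')`, then
`N(a,b)(m)ₚ = ∑_{m'} 2πi (k · a(m')) b(m−m')ₚ` — the space–time Fourier side of
`(v·∇)w = div (v ⊗ w)` for `div v = 0`: the derivative moves outside the convolution. [folklore] -/
theorem nl_apply_of_transversal (a b : ℤ × (Fin 3 → ℤ) → EuclideanSpace ℂ (Fin 3)) (m : ℤ × (Fin 3 → ℤ))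
    (p : Fin 3) (ha : ∀ m' : ℤ × (Fin 3 → ℤ), (∑ jj : Fin 3, ((m'.2 jj : ℤ) : ℂ) * (a m') jj) = 0)
    (hs : ∀ j, Summable fun m' : ℤ × (Fin 3 → ℤ) => a m' j * (dsym j (m.2 - m'.2) * b (m - m') p)) :
    (𝐍[a, b] m) p = ∑' m' : ℤ × (Fin 3 → ℤ),
      (2 * Real.pi * Complex.I * (∑ jj : Fin 3, ((m.2 jj : ℤ) : ℂ) * (a m') jj)) * b (m - m') p := by
  rw [nl_apply, ← Summable.tsum_finsetSum (fun j _ => hs j)]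
  refine tsum_congr fun m' => ?_
  have h1 : ∑ j, a m' j * (dsym j (m.2 - m'.2) * b (m - m') p) =
      (2 * Real.pi * Complex.I * (∑ jj : Fin 3, (((m.2 - m'.2) jj : ℤ) : ℂ) * (a m') jj)) * b (m - m') p := by
    simp only [dsym_apply, Finset.mul_sum, Finset.sum_mul]
    refine Finset.sum_congr rfl fun j _ => ?_
    ring
  rw [h1, kdot_sub, ha m', sub_zero]

/-- **Bound of the symbol in transversal form**: `‖N(a,b)(m)‖ ≤ 18π ⟨k⟩ ∑_{m'} ‖a m'‖ ‖b(m−m')‖`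
when `a` is transversal. [folklore] -/
theorem enorm_nl_le_of_transversal (a b : ℤ × (Fin 3 → ℤ) → EuclideanSpace ℂ (Fin 3)) (m : ℤ × (Fin 3 → ℤ))
    (ha : ∀ m' : ℤ × (Fin 3 → ℤ), (∑ jj : Fin 3, ((m'.2 jj : ℤ) : ℂ) * (a m') jj) = 0)
    (hs : ∀ j p, Summable fun m' : ℤ × (Fin 3 → ℤ) => a m' j * (dsym j (m.2 - m'.2) * b (m - m') p)) :
    ‖𝐍[a, b] m‖ₑ ≤ ENNReal.ofReal (18 * Real.pi) * ENNReal.ofReal (sobolevWeight 1 m.2) *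
      ∑' m' : ℤ × (Fin 3 → ℤ), ‖a m'‖ₑ * ‖b (m - m')‖ₑ := by
  set S : ℝ≥0∞ := ∑' m' : ℤ × (Fin 3 → ℤ), ‖a m'‖ₑ * ‖b (m - m')‖ₑ with hS
  have hcomp : ∀ p, ‖(𝐍[a, b] m) p‖ₑ ≤
      ENNReal.ofReal (2 * Real.pi) * (3 * ENNReal.ofReal (sobolevWeight 1 m.2)) * S := by
    intro p
    rw [nl_apply_of_transversal a b m p ha (fun j => hs j p)]
    refine enorm_tsum_le_tsum_enorm.trans ?_
    rw [hS, ← ENNReal.tsum_mul_left]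
    refine ENNReal.tsum_le_tsum fun m' => ?_
    rw [enorm_mul]
    have h1 : ‖2 * Real.pi * Complex.I * (∑ jj : Fin 3, ((m.2 jj : ℤ) : ℂ) * (a m') jj)‖ₑ ≤
        ENNReal.ofReal (2 * Real.pi) * (3 * ENNReal.ofReal (sobolevWeight 1 m.2)) * ‖a m'‖ₑ := by
      have hw0 : 0 ≤ sobolevWeight 1 m.2 := (sobolevWeight_pos 1 m.2).le
      rw [← ofReal_norm, ← ofReal_norm (a m'), ← ENNReal.ofReal_ofNat 3,
        ← ENNReal.ofReal_mul (by norm_num), ← ENNReal.ofReal_mul (by positivity),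
        ← ENNReal.ofReal_mul (by positivity)]
      refine ENNReal.ofReal_le_ofReal ?_
      rw [norm_mul]
      have hn : ‖(2 * Real.pi * Complex.I : ℂ)‖ = 2 * Real.pi := by
        simp [abs_of_pos Real.pi_pos]
      rw [hn]
      have := SteadyLattice.norm_kdot_le m.2 (a m')
      calc 2 * Real.pi * ‖(∑ jj : Fin 3, ((m.2 jj : ℤ) : ℂ) * (a m') jj)‖
          ≤ 2 * Real.pi * (3 * sobolevWeight 1 m.2 * ‖a m'‖) := mul_le_mul_of_nonneg_left this (by positivity)
        _ = 2 * Real.pi * (3 * sobolevWeight 1 m.2) * ‖a m'‖ := by ring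
    have h2 : ‖b (m - m') p‖ₑ ≤ ‖b (m - m')‖ₑ := SteadyLattice.enorm_apply_le_enorm _ p
    calc ‖2 * Real.pi * Complex.I * (∑ jj : Fin 3, ((m.2 jj : ℤ) : ℂ) * (a m') jj)‖ₑ * ‖b (m - m') p‖ₑ
        ≤ (ENNReal.ofReal (2 * Real.pi) * (3 * ENNReal.ofReal (sobolevWeight 1 m.2)) * ‖a m'‖ₑ) *
            ‖b (m - m')‖ₑ := mul_le_mul' h1 h2
      _ = ENNReal.ofReal (2 * Real.pi) * (3 * ENNReal.ofReal (sobolevWeight 1 m.2)) *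
            (‖a m'‖ₑ * ‖b (m - m')‖ₑ) := by ring
  calc ‖𝐍[a, b] m‖ₑ ≤ ∑ p, ‖(𝐍[a, b] m) p‖ₑ := SteadyLattice.enorm_le_sum_enorm_apply _
    _ ≤ ∑ _p : Fin 3, ENNReal.ofReal (2 * Real.pi) * (3 * ENNReal.ofReal (sobolevWeight 1 m.2)) * S :=
        Finset.sum_le_sum fun p _ => hcomp p
    _ = ENNReal.ofReal (18 * Real.pi) * ENNReal.ofReal (sobolevWeight 1 m.2) * S := by
        simp only [Finset.sum_const, Finset.card_univ, Fintype.card_fin, nsmul_eq_mul, Nat.cast_ofNat]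
        rw [show (18 : ℝ) * Real.pi = 9 * (2 * Real.pi) by ring,
          ENNReal.ofReal_mul (by norm_num : (0:ℝ) ≤ 9)]
        simp only [ENNReal.ofReal_ofNat]
        ring

/-- **The symbol vanishes on the zero spatial modes** for transversal `a` (the Fourier form of
`∫_{T³} (v·∇)w dx = 0` for `div v = 0`: the nonlinearity preserves the spatial mean). [folklore] -/
theorem nl_zero_of_transversal (a b : ℤ × (Fin 3 → ℤ) → EuclideanSpace ℂ (Fin 3)) (n : ℤ)
    (ha : ∀ m' : ℤ × (Fin 3 → ℤ), (∑ jj : Fin 3, ((m'.2 jj : ℤ) : ℂ) * (a m') jj) = 0)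
    (hs : ∀ j p, Summable fun m' : ℤ × (Fin 3 → ℤ) =>
      a m' j * (dsym j (((n, 0) : ℤ × (Fin 3 → ℤ)).2 - m'.2) * b ((n, 0) - m') p)) :
    𝐍[a, b] ((n, 0) : ℤ × (Fin 3 → ℤ)) = 0 := by
  ext p
  rw [nl_apply_of_transversal a b (n, 0) p ha (fun j => hs j p), PiLp.zero_apply]
  simp

/-- `conj (2πi lⱼ) = 2πi (−l)ⱼ`. [folklore] -/
theorem conj_dsym' (j : Fin 3) (l : Fin 3 → ℤ) : conj (dsym j l) = dsym j (-l) := by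
  rw [dsym_apply, dsym_apply]
  simp only [map_mul, map_ofNat, Complex.conj_ofReal, Complex.conj_I, map_intCast, Pi.neg_apply,
    Int.cast_neg]
  ring

/-- **Conjugate symmetry of the symbol**: `N(a,b)(−m) = conj N(a,b)(m)` for conjugate-symmetric
`a`, `b` (realness of `(v·∇)w` for real `v`, `w`; reindex `m' ↦ −m'`, no summability needed).
[folklore] -/
theorem nl_neg (a b : ℤ × (Fin 3 → ℤ) → EuclideanSpace ℂ (Fin 3))
    (ha : ∀ m, a (-m) = EuclideanSpace.conjVec (a m)) (hb : ∀ m, b (-m) = EuclideanSpace.conjVec (b m))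
    (m : ℤ × (Fin 3 → ℤ)) : 𝐍[a, b] (-m) = EuclideanSpace.conjVec (𝐍[a, b] m) := by
  ext p
  rw [nl_apply, EuclideanSpace.conjVec_apply, nl_apply, map_sum]
  refine Finset.sum_congr rfl fun j _ => ?_
  rw [Complex.conj_tsum, ← (Equiv.neg (ℤ × (Fin 3 → ℤ))).tsum_eq]
  refine tsum_congr fun m' => ?_
  simp only [Equiv.neg_apply, map_mul]
  rw [ha m', show -m - -m' = -(m - m') by abel, hb (m - m'), EuclideanSpace.conjVec_apply,
    EuclideanSpace.conjVec_apply, conj_dsym']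
  congr 2
  simp only [Prod.snd_neg, neg_sub_neg, neg_sub]

/-- Summability of the symbol's terms from `∑ ‖a m'‖ < ∞` and a uniform bound on `⟨l⟩ ‖b(·, l)‖`
(one factor absolutely summable, e.g. rapidly decaying). [folklore] -/
theorem summable_nl_term_of_summable {a b : ℤ × (Fin 3 → ℤ) → EuclideanSpace ℂ (Fin 3)}
    (ha : Summable fun m' => ‖a m'‖) {M : ℝ} (hb : ∀ l : ℤ × (Fin 3 → ℤ), sobolevWeight 1 l.2 * ‖b l‖ ≤ M)
    (m : ℤ × (Fin 3 → ℤ)) (j p : Fin 3) :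
    Summable fun m' : ℤ × (Fin 3 → ℤ) => a m' j * (dsym j (m.2 - m'.2) * b (m - m') p) := by
  have hM : 0 ≤ M := le_trans (mul_nonneg (sobolevWeight_pos 1 _).le (norm_nonneg _)) (hb 0)
  refine Summable.of_norm_bounded (ha.mul_right (2 * Real.pi * M)) fun m' => ?_
  rw [norm_mul, norm_mul]
  have h1 : ‖a m' j‖ ≤ ‖a m'‖ := SteadyLattice.norm_apply_le_norm' (a m') j
  have h2 : ‖dsym j (m.2 - m'.2)‖ * ‖b (m - m') p‖ ≤ 2 * Real.pi * M := by
    calc ‖dsym j (m.2 - m'.2)‖ * ‖b (m - m') p‖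
        ≤ (2 * Real.pi * sobolevWeight 1 (m - m').2) * ‖b (m - m')‖ :=
          mul_le_mul (SteadyLattice.norm_dsym_le j _) (SteadyLattice.norm_apply_le_norm' _ p) (norm_nonneg _)
            (mul_nonneg (by positivity) (sobolevWeight_pos 1 _).le)
      _ = 2 * Real.pi * (sobolevWeight 1 (m - m').2 * ‖b (m - m')‖) := by ring
      _ ≤ 2 * Real.pi * M := mul_le_mul_of_nonneg_left (hb _) (by positivity)
  exact mul_le_mul h1 h2 (by positivity) (norm_nonneg _)

/-- Summability of the symbol's terms from finiteness of the majorant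
`∑_{m'} ‖a m'‖ ⟨k−k'⟩ ‖b(m−m')‖ < ∞` (the form delivered by the `L²` theory of §D). [folklore] -/
theorem summable_nl_term_of_ne_top {a b : ℤ × (Fin 3 → ℤ) → EuclideanSpace ℂ (Fin 3)} {m : ℤ × (Fin 3 → ℤ)}
    (h : ∑' m' : ℤ × (Fin 3 → ℤ), ‖a m'‖ₑ * (ENNReal.ofReal (sobolevWeight 1 (m.2 - m'.2)) * ‖b (m - m')‖ₑ) ≠ ∞)
    (j p : Fin 3) :
    Summable fun m' : ℤ × (Fin 3 → ℤ) => a m' j * (dsym j (m.2 - m'.2) * b (m - m') p) := by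
  -- the real majorant is summable
  have hmaj : Summable fun m' : ℤ × (Fin 3 → ℤ) =>
      ‖a m'‖ * (sobolevWeight 1 (m.2 - m'.2) * ‖b (m - m')‖) := by
    have hnn : ∀ m' : ℤ × (Fin 3 → ℤ), 0 ≤ ‖a m'‖ * (sobolevWeight 1 (m.2 - m'.2) * ‖b (m - m')‖) :=
      fun m' => mul_nonneg (norm_nonneg _) (mul_nonneg (sobolevWeight_pos 1 _).le (norm_nonneg _))
    have heq : ∀ m' : ℤ × (Fin 3 → ℤ), ENNReal.ofReal (‖a m'‖ * (sobolevWeight 1 (m.2 - m'.2) * ‖b (m - m')‖)) =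
        ‖a m'‖ₑ * (ENNReal.ofReal (sobolevWeight 1 (m.2 - m'.2)) * ‖b (m - m')‖ₑ) := fun m' => by
      rw [ENNReal.ofReal_mul (norm_nonneg _), ENNReal.ofReal_mul (sobolevWeight_pos 1 _).le, ofReal_norm,
        ofReal_norm]
    have h' : ∑' m' : ℤ × (Fin 3 → ℤ), ENNReal.ofReal (‖a m'‖ * (sobolevWeight 1 (m.2 - m'.2) * ‖b (m - m')‖)) ≠ ∞ := by
      rwa [tsum_congr heq]
    exact (ENNReal.summable_toReal h').congr fun m' => by rw [ENNReal.toReal_ofReal (hnn m')]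
  refine Summable.of_norm_bounded (hmaj.mul_left (2 * Real.pi)) fun m' => ?_
  rw [norm_mul, norm_mul]
  have h1 : ‖a m' j‖ ≤ ‖a m'‖ := SteadyLattice.norm_apply_le_norm' (a m') j
  have h2 : ‖dsym j (m.2 - m'.2)‖ ≤ 2 * Real.pi * sobolevWeight 1 (m.2 - m'.2) := SteadyLattice.norm_dsym_le j _
  have h3 : ‖b (m - m') p‖ ≤ ‖b (m - m')‖ := SteadyLattice.norm_apply_le_norm' _ p
  calc ‖a m' j‖ * (‖dsym j (m.2 - m'.2)‖ * ‖b (m - m') p‖)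
      ≤ ‖a m'‖ * ((2 * Real.pi * sobolevWeight 1 (m.2 - m'.2)) * ‖b (m - m')‖) :=
        mul_le_mul h1 (mul_le_mul h2 h3 (norm_nonneg _) (mul_nonneg (by positivity) (sobolevWeight_pos 1 _).le))
          (by positivity) (norm_nonneg _)
    _ = 2 * Real.pi * (‖a m'‖ * (sobolevWeight 1 (m.2 - m'.2) * ‖b (m - m')‖)) := by ring

/-- Additivity of the symbol in the first slot (summable terms). [folklore] -/
theorem nl_add_left (a₁ a₂ b : ℤ × (Fin 3 → ℤ) → EuclideanSpace ℂ (Fin 3)) (m : ℤ × (Fin 3 → ℤ))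
    (h₁ : ∀ j p, Summable fun m' : ℤ × (Fin 3 → ℤ) => a₁ m' j * (dsym j (m.2 - m'.2) * b (m - m') p))
    (h₂ : ∀ j p, Summable fun m' : ℤ × (Fin 3 → ℤ) => a₂ m' j * (dsym j (m.2 - m'.2) * b (m - m') p)) :
    𝐍[a₁ + a₂, b] m = 𝐍[a₁, b] m + 𝐍[a₂, b] m := by
  ext p
  rw [PiLp.add_apply, nl_apply, nl_apply, nl_apply, ← Finset.sum_add_distrib]
  refine Finset.sum_congr rfl fun j _ => ?_
  rw [← (h₁ j p).tsum_add (h₂ j p)]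
  refine tsum_congr fun m' => ?_
  rw [Pi.add_apply, PiLp.add_apply]
  ring

/-- Additivity of the symbol in the second slot (summable terms). [folklore] -/
theorem nl_add_right (a b₁ b₂ : ℤ × (Fin 3 → ℤ) → EuclideanSpace ℂ (Fin 3)) (m : ℤ × (Fin 3 → ℤ))
    (h₁ : ∀ j p, Summable fun m' : ℤ × (Fin 3 → ℤ) => a m' j * (dsym j (m.2 - m'.2) * b₁ (m - m') p))
    (h₂ : ∀ j p, Summable fun m' : ℤ × (Fin 3 → ℤ) => a m' j * (dsym j (m.2 - m'.2) * b₂ (m - m') p)) :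
    𝐍[a, b₁ + b₂] m = 𝐍[a, b₁] m + 𝐍[a, b₂] m := by
  ext p
  rw [PiLp.add_apply, nl_apply, nl_apply, nl_apply, ← Finset.sum_add_distrib]
  refine Finset.sum_congr rfl fun j _ => ?_
  rw [← (h₁ j p).tsum_add (h₂ j p)]
  refine tsum_congr fun m' => ?_
  rw [Pi.add_apply, PiLp.add_apply]
  ring

/-- Homogeneity of the symbol in the first slot. [folklore] -/
theorem nl_smul_left (c : ℂ) (a b : ℤ × (Fin 3 → ℤ) → EuclideanSpace ℂ (Fin 3)) (m : ℤ × (Fin 3 → ℤ)) :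
    𝐍[c • a, b] m = c • 𝐍[a, b] m := by
  ext p
  rw [PiLp.smul_apply, nl_apply, nl_apply, Finset.smul_sum]
  refine Finset.sum_congr rfl fun j _ => ?_
  rw [smul_eq_mul, ← tsum_mul_left]
  refine tsum_congr fun m' => ?_
  rw [Pi.smul_apply, PiLp.smul_apply, smul_eq_mul]
  ring

/-- Homogeneity of the symbol in the second slot. [folklore] -/
theorem nl_smul_right (c : ℂ) (a b : ℤ × (Fin 3 → ℤ) → EuclideanSpace ℂ (Fin 3)) (m : ℤ × (Fin 3 → ℤ)) :
    𝐍[a, c • b] m = c • 𝐍[a, b] m := by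
  ext p
  rw [PiLp.smul_apply, nl_apply, nl_apply, Finset.smul_sum]
  refine Finset.sum_congr rfl fun j _ => ?_
  rw [smul_eq_mul, ← tsum_mul_left]
  refine tsum_congr fun m' => ?_
  rw [Pi.smul_apply, PiLp.smul_apply, smul_eq_mul]
  ring

end Symbol

/-! ## §D The bilinear `L²` estimate in the maximal-regularity class -/

section Bilinear

/-- Local notation (repeated for this section): the convective symbol. -/
local notation:max "𝐍[" a ", " b "]" m:max =>
  (WithLp.toLp 2 (fun p : Fin 3 => ∑ j : Fin 3, ∑' m' : ℤ × (Fin 3 → ℤ),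
    a m' j * (dsym j (Prod.snd m - Prod.snd m') * b (m - m') p)) : EuclideanSpace ℂ (Fin 3))

/-- Local notation: division by the weight, `(x/Λ)(m) = Λ(m)⁻¹ x(m)` (junk `0⁻¹ = 0` at the
origin, where the families of interest vanish anyway). -/
local notation:max "𝐜" x:max => (fun mm : ℤ × (Fin 3 → ℤ) =>
  ((((|((Prod.fst mm : ℤ) : ℝ)| + freqNormSq (Prod.snd mm))⁻¹ : ℝ) : ℂ) • x mm))

/-- Unfolding the inverse weight. [folklore] -/
theorem cw_apply (x : ℤ × (Fin 3 → ℤ) → EuclideanSpace ℂ (Fin 3)) (m : ℤ × (Fin 3 → ℤ)) :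
    (𝐜 x) m = (((Λ m)⁻¹ : ℝ) : ℂ) • x m := rfl

/-- `‖(x/Λ)(m)‖ = Λ(m)⁻¹ ‖x m‖`. [folklore] -/
theorem enorm_cw (x : ℤ × (Fin 3 → ℤ) → EuclideanSpace ℂ (Fin 3)) (m : ℤ × (Fin 3 → ℤ)) :
    ‖(𝐜 x) m‖ₑ = ENNReal.ofReal ((Λ m)⁻¹) * ‖x m‖ₑ := by
  rw [cw_apply, enorm_smul, ← ofReal_norm (((Λ m)⁻¹ : ℝ) : ℂ), Complex.norm_real,
    Real.norm_of_nonneg (inv_nonneg.2 (wt_nonneg m))]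

/-- **Cauchy–Schwarz, squared form**: `(∑ f g)² ≤ (∑ f²)(∑ g²)` in `ℝ≥0∞`. [folklore] -/
theorem tsum_mul_sq_le {α : Type*} (f g : α → ℝ≥0∞) :
    (∑' i, f i * g i) ^ 2 ≤ (∑' i, f i ^ 2) * (∑' i, g i ^ 2) := by
  have h := SteadyLattice.cauchy_schwarz_ennreal f g
  calc (∑' i, f i * g i) ^ 2 ≤ ((∑' i, f i ^ 2) ^ (1 / 2 : ℝ) * (∑' i, g i ^ 2) ^ (1 / 2 : ℝ)) ^ 2 :=
        pow_le_pow_left' h 2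
    _ = (∑' i, f i ^ 2) * (∑' i, g i ^ 2) := by
        rw [mul_pow, ← ENNReal.rpow_natCast, ← ENNReal.rpow_natCast, ← ENNReal.rpow_mul,
          ← ENNReal.rpow_mul]
        norm_num

/-- **Factorisation of the majorant** for weighted families vanishing on the zero spatial modes:
`‖(x/Λ)(m')‖ ⟨k−k'⟩ ‖(y/Λ)(m−m')‖ = (‖x m'‖ ‖y(m−m')‖) · K(m, m')` with the kernel
`K = ⟨k−k'⟩ Λ(m')⁻¹ Λ(m−m')⁻¹` off `k' = 0`, `k − k' = 0` and `0` there. [folklore] -/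
theorem majorant_eq (x y : ℤ × (Fin 3 → ℤ) → EuclideanSpace ℂ (Fin 3)) (hx : ∀ n : ℤ, x (n, 0) = 0)
    (hy : ∀ n : ℤ, y (n, 0) = 0) (m m' : ℤ × (Fin 3 → ℤ)) :
    ‖(𝐜 x) m'‖ₑ * (ENNReal.ofReal (sobolevWeight 1 (m.2 - m'.2)) * ‖(𝐜 y) (m - m')‖ₑ) =
      (‖x m'‖ₑ * ‖y (m - m')‖ₑ) *
        (if m'.2 = 0 ∨ m.2 - m'.2 = 0 then 0 else
          ENNReal.ofReal (sobolevWeight 1 (m.2 - m'.2) * ((Λ m')⁻¹ * (Λ (m - m'))⁻¹))) := by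
  rw [enorm_cw, enorm_cw]
  by_cases h : m'.2 = 0 ∨ m.2 - m'.2 = 0
  · rw [if_pos h]
    rcases h with h | h
    · have : x m' = 0 := by
        have := hx m'.1
        rwa [show ((m'.1, 0) : ℤ × (Fin 3 → ℤ)) = m' from Prod.ext rfl h.symm] at this
      simp [this]
    · have : y (m - m') = 0 := by
        have := hy (m - m').1
        rwa [show (((m - m').1, 0) : ℤ × (Fin 3 → ℤ)) = m - m' from Prod.ext rfl (by simpa using h.symm)] at this
      simp [this]
  · rw [if_neg h]
    rw [ENNReal.ofReal_mul (sobolevWeight_pos 1 _).le, ENNReal.ofReal_mul (inv_nonneg.2 (wt_nonneg _))]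
    ring

/-- The square of the kernel is the summand of the kernel bound of §B. [folklore] -/
theorem kernel_sq_eq (m m' : ℤ × (Fin 3 → ℤ)) :
    (if m'.2 = 0 ∨ m.2 - m'.2 = 0 then (0 : ℝ≥0∞) else
        ENNReal.ofReal (sobolevWeight 1 (m.2 - m'.2) * ((Λ m')⁻¹ * (Λ (m - m'))⁻¹))) ^ 2 =
      (if m'.2 = 0 ∨ m.2 - m'.2 = 0 then 0 else
        ENNReal.ofReal (sobolevWeight 1 (m.2 - m'.2) ^ 2 * (((Λ m') ^ 2)⁻¹ * ((Λ (m - m')) ^ 2)⁻¹))) := by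
  split_ifs with h
  · simp
  · rw [← ENNReal.ofReal_pow (mul_nonneg (sobolevWeight_pos 1 _).le
      (mul_nonneg (inv_nonneg.2 (wt_nonneg _)) (inv_nonneg.2 (wt_nonneg _))))]
    congr 1
    rw [mul_pow, mul_pow, inv_pow, inv_pow]

/-- **The majorant is square-bounded by the kernel**: for every `m`,
`(∑_{m'} ‖(x/Λ)(m')‖ ⟨k−k'⟩ ‖(y/Λ)(m−m')‖)² ≤ 12 Z · ∑_{m'} ‖x m'‖² ‖y(m−m')‖²`. [folklore] -/
theorem majorant_sq_le (x y : ℤ × (Fin 3 → ℤ) → EuclideanSpace ℂ (Fin 3)) (hx : ∀ n : ℤ, x (n, 0) = 0)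
    (hy : ∀ n : ℤ, y (n, 0) = 0) (m : ℤ × (Fin 3 → ℤ)) :
    (∑' m' : ℤ × (Fin 3 → ℤ), ‖(𝐜 x) m'‖ₑ *
        (ENNReal.ofReal (sobolevWeight 1 (m.2 - m'.2)) * ‖(𝐜 y) (m - m')‖ₑ)) ^ 2 ≤
      (12 * ∑' k : (Fin 3 → ℤ), ENNReal.ofReal ((freqNormSq k)⁻¹) ^ 2) *
        ∑' m' : ℤ × (Fin 3 → ℤ), (‖x m'‖ₑ * ‖y (m - m')‖ₑ) ^ 2 := by
  rw [tsum_congr (majorant_eq x y hx hy m)]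
  refine (tsum_mul_sq_le _ _).trans ?_
  rw [mul_comm]
  gcongr
  rw [tsum_congr (kernel_sq_eq m)]
  exact tsum_kernel_le m

/-- **Fubini and translation**: `∑_m ∑_{m'} ‖x m'‖² ‖y(m−m')‖² = ‖x‖²_{ℓ²} ‖y‖²_{ℓ²}`. [folklore] -/
theorem tsum_tsum_sq_eq (x y : ℤ × (Fin 3 → ℤ) → EuclideanSpace ℂ (Fin 3)) :
    ∑' (m : ℤ × (Fin 3 → ℤ)) (m' : ℤ × (Fin 3 → ℤ)), (‖x m'‖ₑ * ‖y (m - m')‖ₑ) ^ 2 =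
      (∑' m : ℤ × (Fin 3 → ℤ), ‖x m‖ₑ ^ 2) * ∑' m : ℤ × (Fin 3 → ℤ), ‖y m‖ₑ ^ 2 := by
  rw [ENNReal.tsum_comm, ← ENNReal.tsum_mul_right]
  refine tsum_congr fun m' => ?_
  simp only [mul_pow]
  rw [ENNReal.tsum_mul_left]
  congr 1
  exact (Equiv.subRight m').tsum_eq (fun l => ‖y l‖ₑ ^ 2)

/-- **The bilinear `L²` estimate** (the product estimate of the maximal-regularity class in three
space dimensions, on the Fourier side): for families `x`, `y` on `ℤ × ℤ³` vanishing on the zero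
spatial modes,
`∑_m ‖N(x/Λ, y/Λ)(m)‖² ≤ (18π)² · 12Z · ‖x‖²_{ℓ²} ‖y‖²_{ℓ²}`, `Z = ∑_{k≠0}|k|⁻⁴`;
in physical variables `‖(v·∇)w‖_{L²(S¹×T³)} ≲ ‖v‖_X ‖w‖_X` with
`‖v‖_X² = ∑ (|n| + |k|²)² |v̂(n,k)|² ≍ ‖∂ₛv‖²_{L²} + ‖Δv‖²_{L²}` (Iooss 1972, §2; cf. Temam 1979,
Ch. III Lemma 3.4 for the spatial factor). [folklore] -/
theorem tsum_enorm_nl_sq_le (x y : ℤ × (Fin 3 → ℤ) → EuclideanSpace ℂ (Fin 3)) (hx : ∀ n : ℤ, x (n, 0) = 0)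
    (hy : ∀ n : ℤ, y (n, 0) = 0) :
    ∑' m : ℤ × (Fin 3 → ℤ), ‖𝐍[𝐜 x, 𝐜 y] m‖ₑ ^ 2 ≤
      ENNReal.ofReal (18 * Real.pi) ^ 2 * (12 * ∑' k : (Fin 3 → ℤ), ENNReal.ofReal ((freqNormSq k)⁻¹) ^ 2) *
        ((∑' m : ℤ × (Fin 3 → ℤ), ‖x m‖ₑ ^ 2) * ∑' m : ℤ × (Fin 3 → ℤ), ‖y m‖ₑ ^ 2) := by
  set Z12 : ℝ≥0∞ := 12 * ∑' k : (Fin 3 → ℤ), ENNReal.ofReal ((freqNormSq k)⁻¹) ^ 2 with hZ12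
  calc ∑' m : ℤ × (Fin 3 → ℤ), ‖𝐍[𝐜 x, 𝐜 y] m‖ₑ ^ 2
      ≤ ∑' m : ℤ × (Fin 3 → ℤ), (ENNReal.ofReal (18 * Real.pi) *
          ∑' m' : ℤ × (Fin 3 → ℤ), ‖(𝐜 x) m'‖ₑ *
            (ENNReal.ofReal (sobolevWeight 1 (m.2 - m'.2)) * ‖(𝐜 y) (m - m')‖ₑ)) ^ 2 :=
        ENNReal.tsum_le_tsum fun m => pow_le_pow_left' (enorm_nl_le (𝐜 x) (𝐜 y) m) 2
    _ ≤ ∑' m : ℤ × (Fin 3 → ℤ), ENNReal.ofReal (18 * Real.pi) ^ 2 *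
          (Z12 * ∑' m' : ℤ × (Fin 3 → ℤ), (‖x m'‖ₑ * ‖y (m - m')‖ₑ) ^ 2) := by
        refine ENNReal.tsum_le_tsum fun m => ?_
        rw [mul_pow]
        gcongr
        exact majorant_sq_le x y hx hy m
    _ = ENNReal.ofReal (18 * Real.pi) ^ 2 * Z12 *
          ∑' (m : ℤ × (Fin 3 → ℤ)) (m' : ℤ × (Fin 3 → ℤ)), (‖x m'‖ₑ * ‖y (m - m')‖ₑ) ^ 2 := by
        rw [ENNReal.tsum_mul_left, ENNReal.tsum_mul_left, hZ12]
        ring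
    _ = ENNReal.ofReal (18 * Real.pi) ^ 2 * Z12 *
          ((∑' m : ℤ × (Fin 3 → ℤ), ‖x m‖ₑ ^ 2) * ∑' m : ℤ × (Fin 3 → ℤ), ‖y m‖ₑ ^ 2) := by
        rw [tsum_tsum_sq_eq]

/-- The constant of the bilinear estimate is finite. [folklore] -/
theorem bilinearConst_ne_top :
    ENNReal.ofReal (18 * Real.pi) ^ 2 * (12 * ∑' k : (Fin 3 → ℤ), ENNReal.ofReal ((freqNormSq k)⁻¹) ^ 2) ≠ ∞ :=
  ENNReal.mul_ne_top (ENNReal.pow_ne_top ENNReal.ofReal_ne_top)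
    (ENNReal.mul_ne_top (by norm_num) zConst_ne_top)

/-- **Finiteness of the majorant at each frequency** for square-summable `x`, `y` vanishing on
the zero spatial modes: `∑_{m'} ‖(x/Λ)(m')‖ ⟨k−k'⟩ ‖(y/Λ)(m−m')‖ < ∞`, so the symbol
`N(x/Λ, y/Λ)(m)` is an absolutely convergent sum (`summable_nl_term_of_ne_top`). [folklore] -/
theorem majorant_ne_top (x y : ℤ × (Fin 3 → ℤ) → EuclideanSpace ℂ (Fin 3)) (hx : ∀ n : ℤ, x (n, 0) = 0)
    (hy : ∀ n : ℤ, y (n, 0) = 0) (hx2 : ∑' m : ℤ × (Fin 3 → ℤ), ‖x m‖ₑ ^ 2 ≠ ∞)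
    (hy2 : ∑' m : ℤ × (Fin 3 → ℤ), ‖y m‖ₑ ^ 2 ≠ ∞) (m : ℤ × (Fin 3 → ℤ)) :
    ∑' m' : ℤ × (Fin 3 → ℤ), ‖(𝐜 x) m'‖ₑ *
        (ENNReal.ofReal (sobolevWeight 1 (m.2 - m'.2)) * ‖(𝐜 y) (m - m')‖ₑ) ≠ ∞ := by
  have hsq := majorant_sq_le x y hx hy m
  have hF : ∑' m' : ℤ × (Fin 3 → ℤ), (‖x m'‖ₑ * ‖y (m - m')‖ₑ) ^ 2 ≤
      (∑' m' : ℤ × (Fin 3 → ℤ), ‖x m'‖ₑ ^ 2) * ∑' l : ℤ × (Fin 3 → ℤ), ‖y l‖ₑ ^ 2 := by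
    rw [← ENNReal.tsum_mul_right]
    refine ENNReal.tsum_le_tsum fun m' => ?_
    rw [mul_pow]
    gcongr
    exact ENNReal.le_tsum (m - m')
  have hF' : (12 * ∑' k : (Fin 3 → ℤ), ENNReal.ofReal ((freqNormSq k)⁻¹) ^ 2) *
      ∑' m' : ℤ × (Fin 3 → ℤ), (‖x m'‖ₑ * ‖y (m - m')‖ₑ) ^ 2 ≤
      (12 * ∑' k : (Fin 3 → ℤ), ENNReal.ofReal ((freqNormSq k)⁻¹) ^ 2) *
      ((∑' m' : ℤ × (Fin 3 → ℤ), ‖x m'‖ₑ ^ 2) * ∑' l : ℤ × (Fin 3 → ℤ), ‖y l‖ₑ ^ 2) := by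
    gcongr
  have hfin : (∑' m' : ℤ × (Fin 3 → ℤ), ‖(𝐜 x) m'‖ₑ *
      (ENNReal.ofReal (sobolevWeight 1 (m.2 - m'.2)) * ‖(𝐜 y) (m - m')‖ₑ)) ^ 2 ≠ ∞ := by
    refine ne_top_of_le_ne_top ?_ (hsq.trans hF')
    exact ENNReal.mul_ne_top (ENNReal.mul_ne_top (by norm_num) zConst_ne_top) (ENNReal.mul_ne_top hx2 hy2)
  intro htop
  rw [htop, ENNReal.top_pow two_ne_zero] at hfin
  exact hfin rfl

/-- **The symbol of the maximal-regularity class is a genuine (absolutely convergent) sum** at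
every frequency, for square-summable `x`, `y` vanishing on the zero spatial modes. [folklore] -/
theorem summable_nl_term_cw (x y : ℤ × (Fin 3 → ℤ) → EuclideanSpace ℂ (Fin 3)) (hx : ∀ n : ℤ, x (n, 0) = 0)
    (hy : ∀ n : ℤ, y (n, 0) = 0) (hx2 : ∑' m : ℤ × (Fin 3 → ℤ), ‖x m‖ₑ ^ 2 ≠ ∞)
    (hy2 : ∑' m : ℤ × (Fin 3 → ℤ), ‖y m‖ₑ ^ 2 ≠ ∞) (m : ℤ × (Fin 3 → ℤ)) (j p : Fin 3) :
    Summable fun m' : ℤ × (Fin 3 → ℤ) => (𝐜 x) m' j * (dsym j (m.2 - m'.2) * (𝐜 y) (m - m') p) :=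
  summable_nl_term_of_ne_top (a := 𝐜 x) (b := 𝐜 y) (majorant_ne_top x y hx hy hx2 hy2 m) j p

end Bilinear

end TimePeriodicLattice

end Literature.Analysis.FluidPDE
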